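/-
Copyright (c) 2026 the pub-hodgecm-mathlib formalisation cell (harness21).  Prover seat hodgecm-mathlib-K2Liu-p02 (g3), Track B «K2-LIT» ∕
hLiu418 #184♮, unit U5d «ZETA_S», socket #32dR `sig_K2LiuDoublingHeightDecayLocalR2`, organ (B∞) «ARCHIMEDEAN SLICE» (LEAD deal 2026-09-04
03:15Z), brick B1 «SHELL BOUND» — the continuous twin of ★ (A2) `integrable_of_cartanSeries`.  2026-09-04.
-/
import Mathlib.MeasureTheory.Function.L1Space.Integrable
import Mathlib.MeasureTheory.Integral.Lebesgue.Countable
import HarnessLib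

/-!
# Crux `HLiu418`, road `K2_Liu`, unit U5d, socket #32dR — organ (B∞) brick B1: THE SHELL BOUND
# (integrability of a non-negative function from a countable cover by shells of controlled measure and controlled size)

Cell `hodgecm-mathlib`, crux item hLiu418 = `stmt-HodgeConjecture-24832`; squad K2 ∕ K2Liu, LEAD F0P6-plan (g10), planner K2Liu-plan (g2), prover
K2Liu-p02 (g3) (deal 03:15:05Z: the archimedean slice `_harch` of ★ `K2LiuDoublingHeightDecayLocalOfSlices.doublingHeightDecayLocal_of_slices`
at `N = 2`).  THEOREMS ONLY (no `def` ∕ instance ∕ notation ∕ named-fact hypothesis ∕ `sorry`, default heartbeats); lane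
`--supports stmt-HodgeConjecture-24832 --as helper` (count-neutral).  GENERIC measure theory (any measurable space ∕ group).

At the archimedean place the slice `ψ_∞(a) = Φ(ι(ιA placesEmbed(a, 1), 1))` lives on the real Lie group `G_∞ = ∏_w U(H^w)` — compact factors and
ONE `U(1,1)(ℝ)` — where the Cartan decomposition `G_∞ = K·A⁺·K` is a CONTINUUM, not a disjoint union of double cosets; the discrete Cartan bound
★ `K2LiuDoublingHeightSliceCartanBound.integrable_of_cartanSeries` (K2Liu-p05) is replaced by its continuous twin, the DYADIC SHELL BOUND of the
LEAD's road: cover `G_∞ = ⋃_k S_k` by the compact shells `S_k = K·a([k, k+1])·K`, bound the Haar measure of `S_k` (brick B3: `≤ C e^{2k}`) and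
`ψ` on `S_k` (quasi-bi-invariance ★ (A1) + sharp decay at `a_s`, brick B4: `≤ C e^{−k}`), and sum the geometric series (`τ > 2`).
THIS FILE is the summation step, for an ARBITRARY countable cover:

* `lintegral_le_tsum_of_cover` — `∫⁻ f ≤ Σ_k ∫⁻_{S_k} f` for a countable cover (Mathlib `lintegral_iUnion_le`);
* **`integrable_of_shellBound`** — `ψ ≥ 0` a.e.-strongly measurable, `S_k` measurable, `ψ ≤ M_k` on `S_k`, `Σ_k ν(S_k)·M_k < ∞` (finite measures)
  ⟹ `Integrable ψ ν`, with `∫ ψ ≤ Σ_k ν(S_k) M_k`;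
* **`integrable_of_shellBound_quasiInvariant`** — the group form the slice uses: shells `S_k = K·a(I_k)·K` for a set `K`, a parametrised family
  `a : P → G` and parameter windows `I_k`, `ψ(x g y) ≤ c ψ(g)` for `x, y ∈ K`, `ψ(a p) ≤ B_k` on `I_k`, `Σ_k ν(S_k)·B_k < ∞` ⟹ `Integrable ψ ν`
  ([GelbartPiatetskishapiroRallis1987, Part A §6]; [Li1992, §3 Thm. 3.1]; [Knapp2002, Prop. 5.28 (integration in `KA⁺K`)]).

HONEST LABEL.  Count-neutral helper (brick B1 of 5 of organ (B∞); it pays nothing by itself): `HC_CM` is proved only modulo the 7 printed citations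
(2 remaining named inputs: hLiu418 = `stmt-HodgeConjecture-24832`, h413 = `stmt-HodgeConjecture-24833`) until rung 0 closes.
References: [GelbartPiatetskishapiroRallis1987] LNM 1254, Part A §6; [Li1992] J. reine angew. Math. 428, §3 Thm. 3.1; [Knapp2002] *Lie Groups Beyond an
Introduction*, Prop. 5.28; [Garrett2018] §3.10.
-/

set_option autoImplicit false
-- the mandated namespace repeats the single-problem summit's segment (`HodgeConjecture.HodgeConjecture`)
set_option linter.dupNamespace false

noncomputable section

open MeasureTheory Set
open scoped ENNReal Pointwise

namespace Summit.HodgeConjecture.HodgeConjecture.Cruxes.HLiu418.K2LiuDoublingHeightShellBound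

variable {G : Type*} [MeasurableSpace G]

/-! ## §1 Integrals over a countable cover -/

/-- `∫⁻ f ≤ Σ_k ∫⁻_{S_k} f` for a countable cover `⋃_k S_k = G`. [cite: Garrett2018, §3.10] -/
theorem lintegral_le_tsum_of_cover (ν : Measure G) {S : ℕ → Set G} (hcover : (⋃ k, S k) = univ) (f : G → ℝ≥0∞) :
    ∫⁻ x, f x ∂ν ≤ ∑' k, ∫⁻ x in S k, f x ∂ν := by
  calc ∫⁻ x, f x ∂ν = ∫⁻ x in ⋃ k, S k, f x ∂ν := by rw [hcover, Measure.restrict_univ]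
    _ ≤ ∑' k, ∫⁻ x in S k, f x ∂ν := lintegral_iUnion_le S f

/-- on a measurable shell where `ψ ≤ M`, `∫⁻_{S} ofReal ψ ≤ ofReal M · ν(S)`. [cite: Garrett2018, §3.10] -/
theorem setLIntegral_ofReal_le_of_le (ν : Measure G) {S : Set G} (hS : MeasurableSet S) {ψ : G → ℝ} {M : ℝ}
    (hle : ∀ g ∈ S, ψ g ≤ M) : ∫⁻ x in S, ENNReal.ofReal (ψ x) ∂ν ≤ ENNReal.ofReal M * ν S := by
  calc ∫⁻ x in S, ENNReal.ofReal (ψ x) ∂ν ≤ ∫⁻ _ in S, ENNReal.ofReal M ∂ν :=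
        setLIntegral_mono' hS fun x hx => ENNReal.ofReal_le_ofReal (hle x hx)
    _ = ENNReal.ofReal M * ν S := setLIntegral_const S _

/-! ## §2 The shell bound -/

/-- **THE SHELL BOUND.**  Let `G = ⋃_k S_k` be a countable cover by measurable sets of finite measure, `ψ ≥ 0` a.e.-strongly measurable with
`ψ ≤ M_k` on `S_k` (`M_k ≥ 0`), and `Σ_k ν(S_k)·M_k < ∞`.  Then `ψ` is `ν`-integrable (and `∫ ψ ≤ Σ_k ν(S_k) M_k`).  The shells need not be disjoint.
[cite: GelbartPiatetskishapiroRallis1987, Part A §6] [cite: Knapp2002, Prop. 5.28] -/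
theorem integrable_of_shellBound (ν : Measure G) {S : ℕ → Set G} (hcover : (⋃ k, S k) = univ)
    (hS : ∀ k, MeasurableSet (S k)) (hfin : ∀ k, ν (S k) ≠ ∞)
    {ψ : G → ℝ} (hψm : AEStronglyMeasurable ψ ν) (hψ0 : ∀ g, 0 ≤ ψ g)
    {M : ℕ → ℝ} (hM0 : ∀ k, 0 ≤ M k) (hle : ∀ k, ∀ g ∈ S k, ψ g ≤ M k)
    (hsum : Summable fun k => (ν (S k)).toReal * M k) : Integrable ψ ν := by
  refine ⟨hψm, (hasFiniteIntegral_iff_ofReal (Filter.Eventually.of_forall hψ0)).2 ?_⟩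
  refine lt_of_le_of_lt ((lintegral_le_tsum_of_cover ν hcover _).trans
    (ENNReal.tsum_le_tsum fun k => setLIntegral_ofReal_le_of_le ν (hS k) (hle k))) ?_
  -- the bound is `ofReal` of the convergent real series `Σ_k M_k ν(S_k)`
  have hterm : ∀ k, ENNReal.ofReal (M k) * ν (S k) = ENNReal.ofReal (M k * (ν (S k)).toReal) := fun k => by
    rw [ENNReal.ofReal_mul (hM0 k), ENNReal.ofReal_toReal (hfin k)]
  have hnn : ∀ k, 0 ≤ M k * (ν (S k)).toReal := fun k => mul_nonneg (hM0 k) ENNReal.toReal_nonneg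
  have hsum' : Summable fun k => M k * (ν (S k)).toReal := hsum.congr fun k => mul_comm _ _
  rw [tsum_congr hterm, ← ENNReal.ofReal_tsum_of_nonneg hnn hsum']
  exact ENNReal.ofReal_lt_top

/-! ## §3 The group form: shells `K·a(I_k)·K` and a quasi-bi-invariant `ψ` -/

omit [MeasurableSpace G] in
/-- on a shell `K·a(I)·K`, a function with `ψ(x g y) ≤ c ψ(g)` (`x, y ∈ K`) and `ψ(a p) ≤ B` on `I` is `≤ c·B`. [cite: Li1992, §3 Thm. 3.1] -/
theorem le_of_mem_shell [Mul G] {K : Set G} {P : Type*} {a : P → G} {I : Set P} {ψ : G → ℝ} {c B : ℝ} (hc : 0 ≤ c)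
    (hquasi : ∀ x ∈ K, ∀ y ∈ K, ∀ g : G, ψ (x * g * y) ≤ c * ψ g) (hB : ∀ p ∈ I, ψ (a p) ≤ B)
    {g : G} (hg : g ∈ K * (a '' I) * K) : ψ g ≤ c * B := by
  obtain ⟨xz, hxz, y, hy, rfl⟩ := Set.mem_mul.1 hg
  obtain ⟨x, hx, z, hz, rfl⟩ := Set.mem_mul.1 hxz
  obtain ⟨p, hp, rfl⟩ := hz
  exact (hquasi x hx y hy (a p)).trans (mul_le_mul_of_nonneg_left (hB p hp) hc)

/-- **THE SHELL BOUND, GROUP FORM** (the continuous twin of ★ `integrable_of_cartanSeries`).  `K ⊆ G` (in the application: a maximal compact subgroup of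
`G_∞`), `a : P → G` a parametrised family (the boost `s ↦ a_s`), windows `I_k ⊆ P` (`[k, k+1]`) whose shells `S_k = K·a(I_k)·K` are measurable, of finite
measure, and cover `G`; `ψ ≥ 0` a.e.-strongly measurable with `ψ(x g y) ≤ c ψ(g)` for `x, y ∈ K` (★ (A1) `exists_archSlice_quasiBiInvariant`) and
`ψ(a p) ≤ B_k` on `I_k` (`B_k ≥ 0`); if `Σ_k ν(S_k)·B_k < ∞` then `ψ` is `ν`-integrable. [cite: GelbartPiatetskishapiroRallis1987, Part A §6]
[cite: Li1992, §3 Thm. 3.1] [cite: Knapp2002, Prop. 5.28] -/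
theorem integrable_of_shellBound_quasiInvariant [Mul G] (ν : Measure G) (K : Set G) {P : Type*} (a : P → G) (I : ℕ → Set P)
    (hcover : (⋃ k, K * (a '' I k) * K) = univ) (hS : ∀ k, MeasurableSet (K * (a '' I k) * K))
    (hfin : ∀ k, ν (K * (a '' I k) * K) ≠ ∞)
    {ψ : G → ℝ} (hψm : AEStronglyMeasurable ψ ν) (hψ0 : ∀ g, 0 ≤ ψ g)
    {c : ℝ} (hc : 0 ≤ c) (hquasi : ∀ x ∈ K, ∀ y ∈ K, ∀ g : G, ψ (x * g * y) ≤ c * ψ g)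
    {B : ℕ → ℝ} (hB0 : ∀ k, 0 ≤ B k) (hB : ∀ k, ∀ p ∈ I k, ψ (a p) ≤ B k)
    (hsum : Summable fun k => (ν (K * (a '' I k) * K)).toReal * B k) : Integrable ψ ν :=
  integrable_of_shellBound ν hcover hS hfin hψm hψ0 (M := fun k => c * B k) (fun k => mul_nonneg hc (hB0 k))
    (fun k _ hg => le_of_mem_shell hc hquasi (hB k) hg)
    ((hsum.mul_left c).congr fun k => by ring)

end Summit.HodgeConjecture.HodgeConjecture.Cruxes.HLiu418.K2LiuDoublingHeightShellBound

end
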